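import Summits.BirchSwinnertonDyer.BirchSwinnertonDyer.Theorems.KolyvaginDepthDoorDepthTableSteinWuthrichOddRankLValue
import Literature.NumberTheory.EllipticCurves.BurungaleCastellaSkinner2025.PPartBSD
import Literature.NumberTheory.EllipticCurves.Rank1Residual.PrintShape
import Literature.NumberTheory.EllipticCurves.HeegnerPointsKolyvaginExceptionalTwistProofs
import Summits.BirchSwinnertonDyer.Rank1Residual.X9.SurjBigImage
import Literature.NumberTheory.EllipticCurves.LocalReductionKrausMinimality
import HarnessLib

/-!
# Route `KolyvaginDepthDoor`, crux `KolyvaginDepthSupplyKN` (stmt-BirchSwinnertonDyer-22820) —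
# DEPTH TABLE v15, GENERIC: at EVEN rank the depth door closes, per curve, on ONE BSD-QUOTIENT VALUATION of the
# rank-one Heegner twist (Stein–Wuthrich + W. Zhang L8.4 (1) + Burungale–Castella–Skinner 2025 Cor. 1.3.1 /
# W. Zhang 2014 Thm. 1.6 + Gross–Zagier–Kolyvagin, BY NAME)

Helper file of the lead prover of line `levelone` (kdd-p1 g19; `--supports stmt-BirchSwinnertonDyer-22820
--as helper`); it closes nothing and BSD is NOT proved by it.

Companion of `…DepthTableSteinWuthrichOddRankLValue` (g18). There the Heegner twist `T` of an ODD-rank curve has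
analytic rank `0` and Skinner 2016 Thm. C reads the row's datum `#Sel_p(T) ≤ p^{rank}` off ONE rational number
`L(T,1)/Ω_T`. At EVEN rank (the 18 rank-two rows of the depth table) the Heegner twist has analytic rank ONE, and the
printed `p`-part of the Birch–Swinnerton-Dyer formula IN ANALYTIC RANK ONE does the same job:

* `natCard_selmerGroup_eq_of_rankOne_bsdQuotient_bcs` — **Burungale–Castella–Skinner 2025 Cor. 1.3.1 + GZK ⟹
  `#Sel_p(T/ℚ) = p`.** `T/ℚ` globally minimal, non-CM, `p ≥ 5` good ordinary, `ρ̄_{T,p}` onto (whence `T[p]`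
  irreducible and hypothesis (im), `X9.bigIm_of_surj`), Kodaira–Néron at `p` (`p ∤ Tam(T)`), `ord_{s=1} L(T,s) = 1`, and
  the BSD quotient `L'(T,1)/(Ω_T · Reg_T) ∈ ℚ` (rational by Gross–Zagier; it is `#Ш_an(T)·Tam(T)/#T(ℚ)_tors²`) has
  `ord_p ≤ 0` ⟹ `Ш(T)[p] = 0` and `#Sel_p(T) = p^{rank T} = p`.
* `natCard_selmerGroup_eq_of_rankOne_bsdQuotient_zhang` — the same from **W. Zhang 2014 Thm. 1.6** (hypotheses of his
  Thm. 1.4: `ρ̄_{T,p}` onto, (2) `ℓ ∥ N_T`, `ℓ ≡ ±1 (p)` ⟹ `p ∤ v_ℓ(Δ_T)`, (3) for non-square-free `N_T` a ramified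
  multiplicative prime and, if it is the only one, an even number of multiplicative primes) — the preprint-free road,
  available when `T` has an even number of multiplicative primes (twists of the composite-conductor rows).
* `cruxBody_of_twistBSDQuotient_of_steinWuthrich_bcs` — **THE EVEN-RANK ROW MECHANISM.** `W` in the Stein–Wuthrich
  range on W. Zhang's ♠ cell at an admissible Kodaira–Néron prime `p` (hypotheses of g17's
  `cruxBody_of_twistSelmer_of_steinWuthrich`), `K` Heegner (`d_K ∉ {−3,−4}`, `p ∤ d_K`), and a globally minimal `T` with
  `C • T = W.quadraticTwist d_K` carrying the rank-one data above: THEN the CLAUSE of `KolyvaginDepthSupplyKN` holds at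
  `W` verbatim (`#Sel_p` transported along `C`; `p ≤ p^{rank W}`). `T` non-CM is DERIVED from `W` non-CM (`j` is a twist
  invariant).

CONDITIONAL on the named print facts; per `(W, p, K, T)`; nothing class-wide (the open stub (S♭) is untouched); BSD is
NOT proved by it. The numerical content of the datum for the 22 (curve, field) rows of `CLOSING-DATA-v13.md` is the
observatory's `CERT-TABLE.md` (cert-2 g40, PARI: `r_an(T) = 1`, `#Ш_an(T) = 1.000…`, `p ∤ c(T)`, `#T(ℚ)_tors = 1`) —
context only; the tree takes `hr`/`hval` as hypotheses, like every analytic input of the lineage.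

References: [BurungaleCastellaSkinner2025] Cor. 1.3.1 (p. 4), (irr_ℚ), (im) (p. 2); [WZhang2014] Thm. 1.6 (p. 199),
Thm. 1.4 (p. 197), Lemma 8.4 (1), Thm. 9.1; [Darmon2004] Thm. 3.22; [SteinWuthrich2013] Thm. 1.1; [SerreAbelianLadic1968]
IV-23 Lemma 3; [SilvermanAEC2009] X.4.2, X.5 Cor. 5.4, C.15.
-/

set_option linter.dupNamespace false

noncomputable section

open scoped Classical NumberField

namespace Summit.BirchSwinnertonDyer.BirchSwinnertonDyer.Theorems.KolyvaginDepthDoor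

open Literature.NumberTheory.EllipticCurves Literature.NumberTheory.EllipticCurves.ModularForms
  WeierstrassCurve NumberField IsDedekindDomain
open Literature.NumberTheory.EllipticCurves.Rank1Residual
open Summit.BirchSwinnertonDyer.BirchSwinnertonDyer.Theorems

/-- From the printed shape «`ord_p(BSD quotient) = ord_p #Ш(T) + ord_p Tam(T)`» with the quotient's `ord_p ≤ 0`, `p ∤ Tam(T)`
(Kodaira–Néron at `p`) and `Ш(T)` finite: `p ∤ #Ш(T)`, `Ш(T)[p] = 0`, hence the exact descent count `#Sel_p(T) = p^{rank T}` (`T[p]`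
irreducible). Bookkeeping shared by the two roads below. [cite: SilvermanAEC2009, Thm. X.4.2] -/
theorem natCard_selmerGroup_eq_pow_of_padicVal_printShape (T : WeierstrassCurve ℚ) [T.IsElliptic] [T.IsGloballyMinimal]
    (p : ℕ) [hp : Fact p.Prime] (h5 : 5 ≤ p) (hirr : T.HasIrreducibleModPGaloisRep p)
    (hKN : ∀ v : HeightOneSpectrum (𝓞 ℚ), T.HasMultiplicativeReductionAt v → ¬ p ∣ T.ordMinimalDiscriminant v)
    (hfin : Finite T.sha) {q : ℚ}
    (hv : padicValRat p q = (padicValNat p T.shaOrder : ℤ) + padicValNat p T.tamagawaProduct)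
    (hv0 : padicValRat p q ≤ 0) :
    Nat.card (T.selmerGroup p) = p ^ T.mordellWeilRank := by
  have hpP : p.Prime := hp.out
  have htam : ¬ p ∣ T.tamagawaProduct := not_dvd_tamagawaProduct_of_kodairaNeron T p h5 hKN
  have htam0 : padicValNat p T.tamagawaProduct = 0 := padicValNat.eq_zero_of_not_dvd htam
  have hle : ((padicValNat p T.shaOrder : ℕ) : ℤ) + ((padicValNat p T.tamagawaProduct : ℕ) : ℤ) ≤ 0 := by
    rw [← hv]; exact hv0
  have hsha0 : padicValNat p T.shaOrder = 0 := by omega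
  haveI : Finite T.sha := hfin
  have hpos : T.shaOrder ≠ 0 := by
    rw [WeierstrassCurve.shaOrder]; exact Nat.card_pos.ne'
  have hnd : ¬ p ∣ T.shaOrder := by
    rcases padicValNat.eq_zero_iff.mp hsha0 with h | h | h
    · exact absurd h hpP.one_lt.ne'
    · exact absurd h hpos
    · exact h
  have hshaT : (T.sha ⊓ AddSubgroup.torsionBy T.galH1 (p : ℤ) : AddSubgroup T.galH1) = ⊥ :=
    sha_inf_torsionBy_eq_bot_of_not_dvd_natCard T p hpP (by rwa [WeierstrassCurve.shaOrder] at hnd)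
  exact natCard_selmerGroup_eq_pow_rank_of_sha_inf_torsionBy_eq_bot T p hirr hshaT

/-- **Burungale–Castella–Skinner 2025 Cor. 1.3.1 + Gross–Zagier–Kolyvagin ⟹ `#Sel_p(T) = p` from ONE BSD-quotient
valuation** (generic, analytic rank one). `T/ℚ` globally minimal and non-CM; `p ≥ 5` of good ordinary reduction;
`ρ̄_{T,p}` surjective (so `T[p]` is irreducible, and (im) holds: `X9.bigIm_of_surj`, Serre IV-23); Kodaira–Néron at `p`
(`p ∤ ord_v Δ_T` at multiplicative `v`, whence `p ∤ Tam(T)`); `ord_{s=1} L(T,s) = 1`; and the rational number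
`L'(T,1)/(Ω_T·Reg_T)` has `ord_p ≤ 0`. THEN `#Sel_p(T/ℚ) = p`: GZK gives `rank T = 1` and `Ш(T)` finite, BCS Cor. 1.3.1
gives `ord_p(L'(T,1)/(Ω_T Reg_T)) = ord_p #Ш(T) + ord_p Tam(T)`, so `p ∤ #Ш(T)`, `Ш(T)[p] = 0`, and `#Sel_p = p^{rank}`.
CONDITIONAL on the two named facts; per `(T, p)`; BSD is not proved by it.
[cite: BurungaleCastellaSkinner2025, Cor. 1.3.1 (p. 4)] [cite: Darmon2004, Thm. 3.22] [cite: SilvermanAEC2009, Thm. X.4.2] -/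
theorem natCard_selmerGroup_eq_of_rankOne_bsdQuotient_bcs
    (hBCS : BurungaleCastellaSkinner2025.cor131_padicValRat_bsd_rank_le_one)
    (hGZK : rank_eq_analyticRank_of_analyticRank_le_one)
    (T : WeierstrassCurve ℚ) [T.IsElliptic] [T.IsGloballyMinimal] (p : ℕ) [hp : Fact p.Prime] (h5 : 5 ≤ p)
    (hcm : ¬ T.HasCM) (hgood : T.HasGoodReductionAtPrime p) (hord : ¬ (p : ℤ) ∣ T.frobeniusTrace p)
    (hsur : T.HasSurjectiveModNGaloisRep p)
    (hKN : ∀ v : HeightOneSpectrum (𝓞 ℚ), T.HasMultiplicativeReductionAt v → ¬ p ∣ T.ordMinimalDiscriminant v)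
    (hr : T.analyticRank = 1)
    (hval : ∀ q : ℚ, T.leadingLCoeff / ((T.realPeriodRat * T.regulator : ℝ) : ℂ) = (q : ℂ) → padicValRat p q ≤ 0) :
    Nat.card (T.selmerGroup p) = p := by
  have hirr : T.HasIrreducibleModPGaloisRep p := hasIrreducibleModPGaloisRep_of_hasSurjectiveModNGaloisRep T p hsur
  have him : BigIm T p := Summit.BirchSwinnertonDyer.Rank1Residual.X9.bigIm_of_surj T p h5 hsur
  obtain ⟨hrank, hfin⟩ := hGZK T (by rw [hr])
  rw [hr] at hrank
  obtain ⟨q, hq, hv⟩ := hBCS T p hcm (by omega) ⟨hgood, hord⟩ hirr him (by rw [hr]) hfin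
  have hv0 : padicValRat p q ≤ 0 := hval q hq
  rw [natCard_selmerGroup_eq_pow_of_padicVal_printShape T p h5 hirr hKN hfin hv hv0, hrank, pow_one]

/-- **W. Zhang 2014 Thm. 1.6 + Gross–Zagier–Kolyvagin ⟹ `#Sel_p(T) = p` from ONE BSD-quotient valuation** (generic,
analytic rank one; the preprint-free road). `T/ℚ` globally minimal; `p ≥ 5` good ordinary; `ρ̄_{T,p}` surjective; Zhang's
Thm. 1.4 (2): a multiplicative `ℓ ≡ ±1 (mod p)` has `p ∤ v_ℓ(Δ_T)`; Thm. 1.4 (3): if `N_T` is not square-free there is a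
multiplicative `ℓ` with `p ∤ v_ℓ(Δ_T)`, and if exactly one, the number of multiplicative primes is even; Kodaira–Néron at
`p`; `ord_{s=1} L(T,s) = 1`; `ord_p(L'(T,1)/(Ω_T·Reg_T)) ≤ 0`. THEN `#Sel_p(T/ℚ) = p` (Zhang: `ord_p` of the quotient
`= ord_p #Ш + ord_p Tam − 2 ord_p #tors`, and `p ∤ #T(ℚ)_tors` because `T[p]` is irreducible — Mazur,
`Rank1Residual.padicValNat_torsionOrder_eq_zero_of_irreducible`). CONDITIONAL on the two named facts; per `(T, p)`; BSD is not proved by it.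
[cite: WZhang2014, Thm. 1.6 (p. 199), Thm. 1.4 (p. 197)] [cite: Darmon2004, Thm. 3.22] [cite: SilvermanAEC2009, Thm. X.4.2] -/
theorem natCard_selmerGroup_eq_of_rankOne_bsdQuotient_zhang
    (hZ : WZhang2014_padicValRat_bsd_rank_one_ordinary)
    (hGZK : rank_eq_analyticRank_of_analyticRank_le_one)
    (T : WeierstrassCurve ℚ) [T.IsElliptic] [T.IsGloballyMinimal] (p : ℕ) [hp : Fact p.Prime] (h5 : 5 ≤ p)
    (hgood : T.HasGoodReductionAtPrime p) (hord : ¬ (p : ℤ) ∣ T.frobeniusTrace p)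
    (hsur : T.HasSurjectiveModNGaloisRep p)
    (h2 : ∀ (ℓ : ℕ) [Fact ℓ.Prime], T.HasMultiplicativeReductionAtPrime ℓ →
      (p ∣ ℓ - 1 ∨ p ∣ ℓ + 1) → ¬ p ∣ padicValInt ℓ T.minimalDiscriminantInt)
    (h3 : ¬ T.IsSemistable ℤ →
      (∃ ℓ : ℕ, ∃ _ : Fact ℓ.Prime, T.HasMultiplicativeReductionAtPrime ℓ ∧
          ¬ p ∣ padicValInt ℓ T.minimalDiscriminantInt) ∧
        (Set.ncard {ℓ : ℕ | ∃ _ : Fact ℓ.Prime, T.HasMultiplicativeReductionAtPrime ℓ ∧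
            ¬ p ∣ padicValInt ℓ T.minimalDiscriminantInt} = 1 →
          Even (Set.ncard {ℓ : ℕ | ∃ _ : Fact ℓ.Prime, T.HasMultiplicativeReductionAtPrime ℓ})))
    (hKN : ∀ v : HeightOneSpectrum (𝓞 ℚ), T.HasMultiplicativeReductionAt v → ¬ p ∣ T.ordMinimalDiscriminant v)
    (hr : T.analyticRank = 1)
    (hval : ∀ q : ℚ, T.leadingLCoeff / ((T.regulator : ℂ) * (T.realPeriodRat : ℂ)) = (q : ℂ) → padicValRat p q ≤ 0) :
    Nat.card (T.selmerGroup p) = p := by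
  have hirr : T.HasIrreducibleModPGaloisRep p := hasIrreducibleModPGaloisRep_of_hasSurjectiveModNGaloisRep T p hsur
  obtain ⟨hrank, hfin⟩ := hGZK T (by rw [hr])
  rw [hr] at hrank
  obtain ⟨q, hq, hv⟩ := hZ T p h5 hgood hord hsur h2 h3 hr hfin
  have hv0 : padicValRat p q ≤ 0 := hval q hq
  -- `T[p]` irreducible ⟹ `p ∤ #T(ℚ)_tors` (Mazur): the torsion term of Zhang's identity vanishes
  have htors : padicValNat p T.torsionOrder = 0 :=
    Literature.NumberTheory.EllipticCurves.Rank1Residual.padicValNat_torsionOrder_eq_zero_of_irreducible T p hirr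
  have hv' : padicValRat p q = (padicValNat p T.shaOrder : ℤ) + padicValNat p T.tamagawaProduct := by
    rw [hv, htors]; push_cast; ring
  rw [natCard_selmerGroup_eq_pow_of_padicVal_printShape T p h5 hirr hKN hfin hv' hv0, hrank, pow_one]

/-- **THE EVEN-RANK ROW MECHANISM (generic): the clause of `KolyvaginDepthSupplyKN` at a Stein–Wuthrich ♠-cell curve from
ONE BSD-QUOTIENT VALUATION of its rank-one Heegner twist.** `W` globally minimal, non-CM, `2 ≤ rank`, `N_E ≤ 30 000`;
`5 ≤ p < 1000` good ordinary, `ρ_{W,p^n}` onto for all `n`, Kodaira–Néron, ♠ (1), ♠ (2); `K` imaginary quadratic Heegner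
for `N_E`, `d_K ∉ {−3,−4}`, `p ∤ d_K`; `T` a globally minimal model of the twist, `C • T = W.quadraticTwist d_K`, with:
good ordinary `p`, `ρ̄_{T,p}` onto, Kodaira–Néron at `p`, `ord_{s=1} L(T,s) = 1`, `ord_p(L'(T,1)/(Ω_T Reg_T)) ≤ 0`. THEN the
crux's clause holds at `W` verbatim: `T` is non-CM (`j(T) = j(W)`: `not_hasCM_quadraticTwist`, `hasCM_variableChange`),
`#Sel_p(T) = p` (`natCard_selmerGroup_eq_of_rankOne_bsdQuotient_bcs`), transport along `C`
(`natCard_selmerGroup_eq_of_variableChange`), and g17's `cruxBody_of_twistSelmer_of_steinWuthrich` (`p ≤ p^rank`).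
Since `ord L(T,s) = 1` is odd, only EVEN-rank `W` qualify (the twist by a Heegner field flips the sign). CONDITIONAL on
Stein–Wuthrich 2013 Thm. 1.1, W. Zhang 2014 L8.4 (1) / 9.1, Burungale–Castella–Skinner 2025 Cor. 1.3.1 and GZK by name;
per `(W, p, K, T)`; BSD is not proved by it. [cite: SteinWuthrich2013, Thm. 1.1 (p. 1758)]
[cite: WZhang2014, Lemma 8.4 (1) (p. 236), Thm. 9.1 (p. 240)] [cite: BurungaleCastellaSkinner2025, Cor. 1.3.1 (p. 4)]
[cite: Darmon2004, Thm. 3.22] [cite: SilvermanAEC2009, X.5 Cor. 5.4] -/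
theorem cruxBody_of_twistBSDQuotient_of_steinWuthrich_bcs
    (hSW : SteinWuthrich2013_sha_inf_torsionBy_eq_bot_of_two_le_rank)
    (h84 : Literature.NumberTheory.EllipticCurves.WZhang2014_lemma84_exists_minimal_kolyvaginClass_one_selmerCard)
    (hBCS : BurungaleCastellaSkinner2025.cor131_padicValRat_bsd_rank_le_one)
    (hGZK : rank_eq_analyticRank_of_analyticRank_le_one)
    (W : WeierstrassCurve ℚ) [W.IsElliptic] [W.IsGloballyMinimal] (hcm : ¬ W.HasCM) (hr : 2 ≤ W.mordellWeilRank)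
    (hN : W.conductorNorm ℤ ≤ 30000)
    (p : ℕ) [hp : Fact p.Prime] (h5 : 5 ≤ p) (hp1000 : p < 1000) (hgood : W.HasGoodReductionAtPrime p)
    (hord : ¬ (p : ℤ) ∣ W.frobeniusTrace p)
    (htower : ∀ n : ℕ, W.HasSurjectiveModNGaloisRep (p ^ n : ℕ))
    (hKN : ∀ v : HeightOneSpectrum (𝓞 ℚ), W.HasMultiplicativeReductionAt v →
      ¬ p ∣ W.ordMinimalDiscriminant v)
    (hS1 : ∀ (ℓ : ℕ) [Fact ℓ.Prime], W.HasMultiplicativeReductionAtPrime ℓ →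
      ¬ p ∣ padicValInt ℓ W.minimalDiscriminantInt)
    (hS2 : ¬ Squarefree (W.conductorNorm ℤ) →
      (∃ (ℓ : ℕ) (_ : Fact ℓ.Prime), W.HasMultiplicativeReductionAtPrime ℓ ∧
          ¬ p ∣ padicValInt ℓ W.minimalDiscriminantInt) ∧
        ∃ (ℓ₁ ℓ₂ : ℕ) (_ : Fact ℓ₁.Prime) (_ : Fact ℓ₂.Prime), ℓ₁ ≠ ℓ₂ ∧
          W.HasMultiplicativeReductionAtPrime ℓ₁ ∧ W.HasMultiplicativeReductionAtPrime ℓ₂)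
    (K : Type) [Field K] [NumberField K] (hK : IsImaginaryQuadratic K)
    (hD3 : NumberField.discr K ≠ -3) (hD4 : NumberField.discr K ≠ -4)
    (hpD : ¬ ((p : ℤ) ∣ NumberField.discr K))
    [iNZ : NeZero (W.conductorNorm ℤ)] (hH : SatisfiesHeegnerHypothesis (W.conductorNorm ℤ) K)
    (T : WeierstrassCurve ℚ) [T.IsElliptic] [T.IsGloballyMinimal] (C : WeierstrassCurve.VariableChange ℚ)
    (hC : C • T = W.quadraticTwist (NumberField.discr K : ℚ))
    (hTgood : T.HasGoodReductionAtPrime p) (hTord : ¬ (p : ℤ) ∣ T.frobeniusTrace p)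
    (hTsur : T.HasSurjectiveModNGaloisRep p)
    (hTKN : ∀ v : HeightOneSpectrum (𝓞 ℚ), T.HasMultiplicativeReductionAt v → ¬ p ∣ T.ordMinimalDiscriminant v)
    (hTr : T.analyticRank = 1)
    (hval : ∀ q : ℚ, T.leadingLCoeff / ((T.realPeriodRat * T.regulator : ℝ) : ℂ) = (q : ℂ) → padicValRat p q ≤ 0) :
    ∃ (p : ℕ) (hp : Fact p.Prime), 5 ≤ p ∧ W.HasGoodReductionAtPrime p ∧
      ¬ (p : ℤ) ∣ W.frobeniusTrace p ∧ (∀ n : ℕ, W.HasSurjectiveModNGaloisRep (p ^ n : ℕ)) ∧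
      (∀ v : HeightOneSpectrum (𝓞 ℚ), W.HasMultiplicativeReductionAt v →
        ¬ p ∣ W.ordMinimalDiscriminant v) ∧
      ∃ (K : Type) (_ : Field K) (_ : NumberField K), IsImaginaryQuadratic K ∧
        NumberField.discr K ≠ -3 ∧ NumberField.discr K ≠ -4 ∧
        ∃ (_ : NeZero (W.conductorNorm ℤ)), SatisfiesHeegnerHypothesis (W.conductorNorm ℤ) K ∧
        ∃ (Dt : ModularParametrizationData W (W.conductorNorm ℤ)) (β : ℤ) (ι : K →+* ℂ) (n₁ : ℕ)
          (d : KolyvaginHeegnerData Dt β ι n₁), Squarefree n₁ ∧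
          (∀ q ∈ n₁.primeFactors, Zhang2014.IsKolyvaginPrime (W.conductorNorm ℤ) W K p q) ∧
          d.kolyvaginClass hp.out 1 ≠ 0 ∧
          (n₁.primeFactors.card + 1 ≤ W.mordellWeilRank ∨
            (n₁.primeFactors.card ≤ W.mordellWeilRank ∧
              n₁.primeFactors.card + 1 ≤ (W.quadraticTwist (NumberField.discr K : ℚ)).mordellWeilRank)) := by
  have hdK : (NumberField.discr K : ℚ) ≠ 0 := by exact_mod_cast NumberField.discr_ne_zero K
  -- `T` is non-CM: `j(T) = j(C • T) = j(W^{(d_K)}) = j(W)`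
  have hTcm : ¬ T.HasCM := by
    intro hT
    have h1 : (C • T).HasCM := hasCM_variableChange T C hT
    rw [hC] at h1
    exact not_hasCM_quadraticTwist W hdK hcm h1
  have hSelT : Nat.card (T.selmerGroup p) = p :=
    natCard_selmerGroup_eq_of_rankOne_bsdQuotient_bcs hBCS hGZK T p h5 hTcm hTgood hTord hTsur hTKN hTr hval
  have hSel : Nat.card ((W.quadraticTwist (NumberField.discr K : ℚ)).selmerGroup p) = p := by
    rw [← natCard_selmerGroup_eq_of_variableChange (p : ℤ) hC]; exact hSelT
  refine cruxBody_of_twistSelmer_of_steinWuthrich hSW h84 W hcm hr hN p h5 hp1000 hgood hord htower hKN hS1 hS2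
    K hK hD3 hD4 hpD hH ?_
  rw [hSel]
  calc p = p ^ 1 := (pow_one p).symm
    _ ≤ p ^ W.mordellWeilRank := Nat.pow_le_pow_right hp.out.pos (le_trans (by norm_num) hr)

/-- From a size bound to Silverman's criterion at every prime `q ≥ M`: if `Δ ≠ 0` and `|Δ| < M¹²` then no `q ≥ M` has
`q¹² ∣ Δ` (let alone `q⁴ ∣ c₄` too) — the large-prime half of the hypothesis of `isGloballyMinimal_of_int_kraus` for the
Kraus-at-`2` twist models of the depth table (variant of the tree's bounded check, which starts at `q = 2`). [folklore] -/
theorem not_pow_twelve_dvd_and_of_natAbs_lt {a : List ℤ}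
    (h0 : Rank1Residual.X11RankOneCertificates.discOf a ≠ 0) {M : ℕ}
    (hlt : (Rank1Residual.X11RankOneCertificates.discOf a).natAbs < M ^ 12) {q : ℕ} (hq : M ≤ q) :
    ¬ ((q : ℤ) ^ 12 ∣ Rank1Residual.X11RankOneCertificates.discOf a ∧
      (q : ℤ) ^ 4 ∣ Rank1Residual.X11RankOneCertificates.c4Of a) := by
  rintro ⟨h12, -⟩
  have h12' : q ^ 12 ∣ (Rank1Residual.X11RankOneCertificates.discOf a).natAbs := by
    rw [← Int.natCast_dvd]; exact_mod_cast h12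
  have hpos : 0 < (Rank1Residual.X11RankOneCertificates.discOf a).natAbs := Int.natAbs_pos.mpr h0
  have hle : q ^ 12 ≤ (Rank1Residual.X11RankOneCertificates.discOf a).natAbs := Nat.le_of_dvd hpos h12'
  have hge : M ^ 12 ≤ q ^ 12 := Nat.pow_le_pow_left hq 12
  omega

end Summit.BirchSwinnertonDyer.BirchSwinnertonDyer.Theorems.KolyvaginDepthDoor

end
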